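import Literature.Analysis.FunctionSpaces.TorusCubeDescentRungFlux
import HarnessLib

/-!
# The flux into a rung of the descent ladder, BEST-APPROXIMATION form of the spectral tail hypothesis

Analysis/FunctionSpaces proof file (everything proved).  `TorusCubeDescentRungFlux.abs_rungFlux_le` measures the spectral tail of the
drift `b` by its sup-norm distance to its SHARP Fourier truncation `fourierTruncate (nS − 2Δ) b`; in sup norm that truncation costs
the spherical Lebesgue constant (`~ Q^{(d−1)/2}`), a loss no analytic-regularity estimate of a multiscale carrier can afford
(cell note F-k3l-8).  Here the SAME bound is proved under the weaker and natural hypothesis: `b` is within `W n` (sup norm) of SOME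
real trigonometric polynomial with frequencies in the CUBE `‖k‖_∞ ≤ nS − 2Δ` (`∃ t, IsConjSymm t ∧ ‖b − realTrigPoly (cubeSupp (nS−2Δ)) t‖_∞ ≤ W n`)
— the tail tool `abs_integral_mul_inner_realTrigPoly_le_of_coeff_vanish` never needed more, and the spectral gaps of the rung pieces
hold for cubes (`mFourierCoeff_rungPiece_eq_zero_of_cube`, `mFourierCoeff_topPiece_eq_zero_of_cube`: `cube(nS−2Δ) + cube(H_ℓ+2Δ) ⊆ cube(H_{ℓ−n})`).
The distance is then fed by a Jackson/Bohr–Favard estimate (derivative sup norms, no Lebesgue constant).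

* `abs_rungFlux_le_of_approx` — `|∫ ⟨u, (b·∇) P_{χ_ℓ²} u⟩| ≤ 2π(H_ℓ+2Δ)√E_ℓ · [(2d²Λ/Δ)√E_{ℓ−1} + d Σ_{i<ℓ−1} W(ℓ−1−i)√E_i + d W(ℓ)‖u‖₂]`.

Consumer: cell `ad-ideate`, K1L_D `stmt-AnomalousDissipation-27980`, W3-E (ii) `stub_effectiveFrameEnergyL_bandKill` (F-k3l-7/8).
## Mathlib / tree search
Tree: `TorusCubeDescentRungs`, `TorusCubeDescentRungFlux`, `TorusCubeFluxLocalisation` (tail tool, `abs_cubeFlux_sub_remainder_le`),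
`TorusCubeCutoffCommutator` (`cubeSupp`, `mem_cubeSupp`, `neg_mem_cubeSupp`).  Mathlib: `Finset.sum_range_sub'`, `abs_sub_abs_le_abs_sub`.
## References
* R. J. DiPerna, P.-L. Lions, Invent. Math. 98 (1989), §II.1 Lemma II.1. [`DiPernaLions1989`]
* L. Grafakos, *Classical Fourier Analysis* (3rd ed., 2014), §3.1.3. [`Grafakos2014`] -/

noncomputable section

open MeasureTheory Set Filter Complex UnitAddTorus Function Finset
open scoped ENNReal InnerProductSpace ComplexConjugate

namespace Literature.Analysis.FunctionSpaces
namespace Torus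

variable {d : Type*} [Fintype d] [DecidableEq d]

section RungFluxApprox

open EuclideanSpace

variable {K₀ S Δ : ℕ}

/-- **A rung piece does not see a cube-band-limited part of the drift**: for `i + 1 + n = ℓ` (`n ≥ 1`), the coefficients of
`P_i u − P_{i+1} u` vanish on `cube(nS − 2Δ) + cube(H_ℓ + 2Δ)` (inside the plateau cube of rung `i+1`). [cite: Grafakos2014, §3.1.3] -/
theorem mFourierCoeff_rungPiece_eq_zero_of_cube (hΔ : 0 < Δ) (hS : 2 * Δ ≤ S) {i n ℓ : ℕ} (hn : 1 ≤ n) (hinℓ : i + 1 + n = ℓ)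
    (hℓ : ℓ * S ≤ K₀ + S) {u : UnitAddTorus d → EuclideanSpace ℝ d} (hu : Integrable u volume)
    {y k : d → ℤ} (hy : y ∈ cubeSupp d (n * S - 2 * Δ)) (hk : k ∈ cubeSupp d (rungHeight K₀ S ℓ + 2 * Δ)) :
    mFourierCoeff (EuclideanSpace.complexify ∘ (rungProj K₀ S Δ i u - rungProj K₀ S Δ (i + 1) u)) (y + k) = 0 := by
  have hv : rungProj K₀ S Δ i u - rungProj K₀ S Δ (i + 1) u = realTrigPoly (ladderSupp d K₀ S Δ)
      (fun m => (((rungSym K₀ S Δ i m - rungSym K₀ S Δ (i + 1) m : ℝ)) : ℂ) • mFourierCoeff (EuclideanSpace.complexify ∘ u) m) := by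
    rw [rungProj, rungProj, ← realTrigPoly_sub]
    congr 1; funext m; rw [Pi.sub_apply, Complex.ofReal_sub, sub_smul]
  have hvc : IsConjSymm (fun m => (((rungSym K₀ S Δ i m - rungSym K₀ S Δ (i + 1) m : ℝ)) : ℂ) •
      mFourierCoeff (EuclideanSpace.complexify ∘ u) m) :=
    (isConjSymm_mFourierCoeff hu).real_weight fun m => by simp only [rungSym, cubeSym_neg]
  have hLsym : ∀ m ∈ ladderSupp d K₀ S Δ, -m ∈ ladderSupp d K₀ S Δ := fun m hm => neg_mem_ladderSupp hm
  rw [hv, mFourierCoeff_realTrigPoly hLsym hvc]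
  split_ifs with hm
  · have hcube : ∀ j, |(y + k) j| ≤ (rungHeight K₀ S (i + 1) : ℤ) := by
      intro j
      have h1 := (mem_cubeSupp.1 hy) j
      have h2 := (mem_cubeSupp.1 hk) j
      have h3 : ((rungHeight K₀ S (i + 1) : ℕ) : ℤ) = rungHeight K₀ S ℓ + n * S := by
        have := rungHeight_add (K₀ := K₀) (S := S) (i := i + 1) (n := n) (by rw [hinℓ]; exact hℓ)
        rw [hinℓ] at this; exact_mod_cast this.symm
      have h2Δ : 2 * Δ ≤ n * S := le_trans hS (Nat.le_mul_of_pos_left S hn)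
      have hnS : ((n * S - 2 * Δ : ℕ) : ℤ) = (n * S : ℕ) - 2 * Δ := by push_cast [Nat.cast_sub h2Δ]; ring
      rw [Pi.add_apply, h3]
      rw [hnS] at h1
      push_cast at h1 h2 ⊢
      have := abs_add_le (y j) (k j)
      linarith
    have hi1 : (i + 1) * S ≤ K₀ + S := le_trans (Nat.mul_le_mul_right _ (by omega)) hℓ
    obtain ⟨e1, e2⟩ := rungSym_eq_one_of_cube (K₀ := K₀) (Δ := Δ) hΔ hi1 hcube
    rw [e1, e2]; simp
  · rfl

/-- **The top piece does not see a cube-band-limited part of the drift**: for `ℓ ≥ 1`, the coefficients of `u − P_0 u` vanish on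
`cube(ℓS − 2Δ) + cube(H_ℓ + 2Δ)`. [cite: Grafakos2014, §3.1.3] -/
theorem mFourierCoeff_topPiece_eq_zero_of_cube (hΔ : 0 < Δ) (hS : 2 * Δ ≤ S) {ℓ : ℕ} (hℓ1 : 1 ≤ ℓ) (hℓ : ℓ * S ≤ K₀ + S)
    {u : UnitAddTorus d → EuclideanSpace ℝ d} (hu : Integrable u volume)
    {y k : d → ℤ} (hy : y ∈ cubeSupp d (ℓ * S - 2 * Δ)) (hk : k ∈ cubeSupp d (rungHeight K₀ S ℓ + 2 * Δ)) :
    mFourierCoeff (EuclideanSpace.complexify ∘ (u - rungProj K₀ S Δ 0 u)) (y + k) = 0 := by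
  have hcube : ∀ j, |(y + k) j| ≤ (K₀ : ℤ) + S := by
    intro j
    have h1 := (mem_cubeSupp.1 hy) j
    have h2 := (mem_cubeSupp.1 hk) j
    have h3 : ((rungHeight K₀ S ℓ : ℕ) : ℤ) + ℓ * S = K₀ + S := by
      have := rungHeight_add (K₀ := K₀) (S := S) (i := 0) (n := ℓ) (by rw [zero_add]; exact hℓ)
      rw [zero_add] at this
      have e : rungHeight K₀ S 0 = K₀ + S := by simp [rungHeight]
      rw [e] at this; exact_mod_cast this
    have h2Δ : 2 * Δ ≤ ℓ * S := le_trans hS (Nat.le_mul_of_pos_left S hℓ1)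
    have hnS : ((ℓ * S - 2 * Δ : ℕ) : ℤ) = (ℓ * S : ℕ) - 2 * Δ := by push_cast [Nat.cast_sub h2Δ]; ring
    rw [hnS] at h1
    rw [Pi.add_apply]
    push_cast at h1 h2 h3 ⊢
    have := abs_add_le (y j) (k j)
    linarith
  have hmemF : y + k ∈ ladderSupp d K₀ S Δ := by
    rw [ladderSupp, mem_cubeSupp]; intro j; have := hcube j; push_cast; linarith
  have e0 : rungSym K₀ S Δ 0 (y + k) = 1 :=
    cubeSym_eq_one hΔ fun j => by have := hcube j; simp [rungHeight]; exact this
  have hP : Integrable (rungProj K₀ S Δ 0 u) volume := (memLp_realTrigPoly _ _ 2).integrable one_le_two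
  have hsub : (EuclideanSpace.complexify ∘ (u - rungProj K₀ S Δ 0 u)) =
      (EuclideanSpace.complexify ∘ fun x => u x - (1 : ℝ) • rungProj K₀ S Δ 0 u x) := by
    funext x; simp
  have hLsym : ∀ m ∈ ladderSupp d K₀ S Δ, -m ∈ ladderSupp d K₀ S Δ := fun m hm => neg_mem_ladderSupp hm
  rw [hsub, mFourierCoeff_complexify_sub_const_smul hu hP, rungProj,
    mFourierCoeff_realTrigPoly hLsym ((isConjSymm_mFourierCoeff hu).real_weight fun m => by simp only [rungSym, cubeSym_neg]),
    if_pos hmemF, e0]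
  simp

/-- **THE FLUX INTO RUNG `ℓ ≥ 1` AT A FIXED TIME.**  For `u ∈ L²`, a continuous weakly divergence-free `Λ`-Lipschitz drift `b`
whose sup-norm distance to its Fourier truncation at radius `n S − 2Δ` is at most `W n` (`1 ≤ n ≤ ℓ`), the transport flux into the
`(rungSym ℓ)²`-weighted energy is at most

  `2π (H_ℓ + 2Δ) √E_ℓ · [ (2d²Λ/Δ) √E_{ℓ−1} + d Σ_{i<ℓ−1} W(ℓ−1−i) √E_i + d W(ℓ) ‖u‖₂ ]`:

the previous rung feeds rung `ℓ` through the commutator (Lipschitz constant only), rung `i < ℓ − 1` only through the spectral tail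
of `b` beyond the gap `(ℓ−1−i) S − 2Δ`, and the rest of `u` through the tail beyond `ℓ S − 2Δ`.
[cite: DiPernaLions1989, §II.1 Lemma II.1] -/
theorem abs_rungFlux_le_of_approx (hΔ : 0 < Δ) (hS : 2 * Δ ≤ S) {ℓ : ℕ} (hℓ1 : 1 ≤ ℓ) (hℓ : ℓ * S ≤ K₀ + S)
    {b : UnitAddTorus d → EuclideanSpace ℝ d} (hbc : Continuous b) (hdiv : IsWeaklyDivFree b) {Λ : ℝ} (hΛ : 0 ≤ Λ)
    (hbL : ∀ x y, ‖b x - b y‖ ≤ Λ * ‖reprc (x - y)‖)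
    {u : UnitAddTorus d → EuclideanSpace ℝ d} (hu : MemLp u 2 volume)
    {W : ℕ → ℝ} (hW : ∀ n, 1 ≤ n → n ≤ ℓ → ∃ t : (d → ℤ) → EuclideanSpace ℂ d, IsConjSymm t ∧
      ∀ x, ‖b x - realTrigPoly (cubeSupp d (n * S - 2 * Δ)) t x‖ ≤ W n) :
    |∫ x, ⟪u x, convect b (realTrigPoly (ladderSupp d K₀ S Δ)
        (fun k => (((rungSym K₀ S Δ ℓ k) ^ 2 : ℝ) : ℂ) • mFourierCoeff (EuclideanSpace.complexify ∘ u) k)) x⟫_ℝ| ≤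
      2 * Real.pi * (rungHeight K₀ S ℓ + 2 * Δ) * Real.sqrt (rungEnergy K₀ S Δ ℓ u) *
        (2 * (Fintype.card d) ^ 2 * Λ / Δ * Real.sqrt (rungEnergy K₀ S Δ (ℓ - 1) u) +
          Fintype.card d * ∑ i ∈ Finset.range (ℓ - 1), W (ℓ - 1 - i) * Real.sqrt (rungEnergy K₀ S Δ i u) +
          Fintype.card d * W ℓ * Real.sqrt (∫ x, ‖u x‖ ^ 2)) := by
  classical
  obtain ⟨ℓ', rfl⟩ : ∃ ℓ', ℓ = ℓ' + 1 := ⟨ℓ - 1, by omega⟩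
  simp only [Nat.add_sub_cancel]
  -- ### notation
  set F : Finset (d → ℤ) := ladderSupp d K₀ S Δ with hF
  set X : (d → ℤ) → EuclideanSpace ℂ d := mFourierCoeff (EuclideanSpace.complexify ∘ u) with hX
  set H : ℕ := rungHeight K₀ S (ℓ' + 1) with hH
  set Fl : Finset (d → ℤ) := cubeSupp d (H + 2 * Δ) with hFl
  set P : ℕ → UnitAddTorus d → EuclideanSpace ℝ d := fun i => rungProj K₀ S Δ i u with hP
  have hui : Integrable u volume := hu.integrable one_le_two
  have hXc : IsConjSymm X := isConjSymm_mFourierCoeff hui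
  have hLsym : ∀ m ∈ F, -m ∈ F := fun m hm => neg_mem_ladderSupp hm
  have hFlsym : ∀ k ∈ Fl, -k ∈ Fl := fun k hk => neg_mem_cubeSupp hk
  have hba : ∀ a, Continuous fun x => b x a := fun a => (PiLp.continuous_apply 2 (fun _ : d => ℝ) a).comp hbc
  have hPm : ∀ i, MemLp (P i) 2 volume := fun i => memLp_realTrigPoly (ladderSupp d K₀ S Δ) _ 2
  have hχℓ : ∀ k : d → ℤ, rungSym K₀ S Δ (ℓ' + 1) k = cubeSym H Δ k := fun k => rfl
  -- the test field lives on the small cube `Fl`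
  have htest : realTrigPoly F (fun k => (((rungSym K₀ S Δ (ℓ' + 1) k) ^ 2 : ℝ) : ℂ) • X k) =
      realTrigPoly Fl (fun k => (((cubeSym H Δ k) ^ 2 : ℝ) : ℂ) • X k) := by
    refine realTrigPoly_eq_of_vanish (fun k _ hk => ?_) (fun k _ hk => ?_)
    · rw [hχℓ, cubeSym_eq_zero_of_not_mem hk]; simp
    · show (((rungSym K₀ S Δ (ℓ' + 1) k) ^ 2 : ℝ) : ℂ) • X k = 0
      rw [rungSym_eq_zero_of_not_mem hk]; simp
  rw [htest]
  -- ### Step 1: bulk + remainder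
  have hχχ' : ∀ k : d → ℤ, rungSym K₀ S Δ ℓ' k * cubeSym H Δ k = cubeSym H Δ k := fun k => by
    rw [← hχℓ]; exact rungSym_mul_succ (K₀ := K₀) hΔ hS hℓ k
  have hmain := abs_cubeFlux_sub_remainder_le H hΔ hbc hdiv hΛ hbL hu (χ' := rungSym K₀ S Δ ℓ') (F' := F) hLsym
    (fun k hk => rungSym_eq_zero_of_not_mem hk) (fun k => by simp only [rungSym, cubeSym_neg]) hχχ'
  rw [sum_cubeSupp_rung_eq_rungEnergy] at hmain
  -- the bulk bound in the target form
  have hEprev : Real.sqrt (∑ k ∈ F, ‖((rungSym K₀ S Δ ℓ' k : ℝ) : ℂ) • X k‖ ^ 2) = Real.sqrt (rungEnergy K₀ S Δ ℓ' u) := rfl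
  rw [hEprev] at hmain
  -- ### Step 2: remainder, axis by axis
  have hΦ : ∀ a, (fun k : d → ℤ => (2 * Real.pi * Complex.I * (k a)) • ((((cubeSym H Δ k) ^ 2 : ℝ) : ℂ) • X k)) =
      rungTestCoeff K₀ S Δ (ℓ' + 1) u a := fun a => rfl
  have hΦc : ∀ a, IsConjSymm (rungTestCoeff K₀ S Δ (ℓ' + 1) u a) := fun a => isConjSymm_rungTestCoeff hui _ a
  have hΦn : ∀ a, Real.sqrt (∑ k ∈ Fl, ‖rungTestCoeff K₀ S Δ (ℓ' + 1) u a k‖ ^ 2) ≤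
      2 * Real.pi * (H + 2 * Δ) * Real.sqrt (rungEnergy K₀ S Δ (ℓ' + 1) u) := fun a => sqrt_sum_rungTestCoeff_le _ u a
  have hmain' : |(∫ x, ⟪u x, convect b (realTrigPoly Fl (fun k => (((cubeSym H Δ k) ^ 2 : ℝ) : ℂ) • X k)) x⟫_ℝ) -
      ∑ a, ∫ x, b x a * ⟪u x - P ℓ' x, realTrigPoly Fl (rungTestCoeff K₀ S Δ (ℓ' + 1) u a) x⟫_ℝ| ≤
      4 * Real.pi * (Fintype.card d) ^ 2 * Λ * (H + 2 * Δ) / Δ * Real.sqrt (rungEnergy K₀ S Δ ℓ' u) *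
        Real.sqrt (rungEnergy K₀ S Δ (ℓ' + 1) u) := hmain
  -- telescoping of the low part: `u − P ℓ' = (u − P 0) + Σ_{i<ℓ'} (P i − P (i+1))`
  have htel : ∀ x, u x - P ℓ' x = (u - P 0) x + ∑ i ∈ Finset.range ℓ', (P i - P (i + 1)) x := by
    intro x; simp only [Pi.sub_apply]; rw [Finset.sum_range_sub' (fun i => P i x)]; abel
  have hrem : ∀ a, |∫ x, b x a * ⟪u x - P ℓ' x, realTrigPoly Fl (rungTestCoeff K₀ S Δ (ℓ' + 1) u a) x⟫_ℝ| ≤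
      (∑ i ∈ Finset.range ℓ', W (ℓ' - i) * Real.sqrt (rungEnergy K₀ S Δ i u) + W (ℓ' + 1) * Real.sqrt (∫ x, ‖u x‖ ^ 2)) *
        (2 * Real.pi * (H + 2 * Δ) * Real.sqrt (rungEnergy K₀ S Δ (ℓ' + 1) u)) := by
    intro a
    set Φ := realTrigPoly Fl (rungTestCoeff K₀ S Δ (ℓ' + 1) u a) with hΦdef
    have hΦcont : Continuous Φ := continuous_realTrigPoly _ _
    have hI : ∀ v : UnitAddTorus d → EuclideanSpace ℝ d, MemLp v 2 volume →
        Integrable (fun x => b x a * ⟪v x, Φ x⟫_ℝ) volume := fun v hv => integrable_mul_inner hv (hba a) hΦcont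
    have hsplit : (∫ x, b x a * ⟪u x - P ℓ' x, Φ x⟫_ℝ) = (∫ x, b x a * ⟪(u - P 0) x, Φ x⟫_ℝ) +
        ∑ i ∈ Finset.range ℓ', ∫ x, b x a * ⟪(P i - P (i + 1)) x, Φ x⟫_ℝ := by
      rw [← integral_finsetSum _ fun i _ => hI (P i - P (i + 1)) ((hPm i).sub (hPm (i + 1))),
        ← integral_add (hI (u - P 0) (hu.sub (hPm 0)))
          (integrable_finsetSum _ fun i _ => hI (P i - P (i + 1)) ((hPm i).sub (hPm (i + 1))))]
      refine integral_congr_ae (ae_of_all _ fun x => ?_)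
      dsimp only
      rw [htel x, inner_add_left, sum_inner, mul_add, Finset.mul_sum]
    rw [hsplit, add_mul, add_comm]
    refine (abs_add_le _ _).trans (add_le_add ?_ ?_)
    · -- the rung pieces
      refine (Finset.abs_sum_le_sum_abs _ _).trans ?_
      rw [Finset.sum_mul]
      refine Finset.sum_le_sum fun i hi => ?_
      rw [Finset.mem_range] at hi
      have hn1 : 1 ≤ ℓ' - i := by omega
      have hin : i + 1 + (ℓ' - i) = ℓ' + 1 := by omega
      have hvan : ∀ y ∈ cubeSupp d ((ℓ' - i) * S - 2 * Δ), ∀ k ∈ Fl,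
          mFourierCoeff (EuclideanSpace.complexify ∘ (P i - P (i + 1))) (y + k) = 0 := fun y hy k hk =>
        mFourierCoeff_rungPiece_eq_zero_of_cube (K₀ := K₀) hΔ hS hn1 hin hℓ hui hy hk
      obtain ⟨t, htc, htW⟩ := hW _ hn1 (by omega)
      have hε : ∀ x, |b x a - realTrigPoly (cubeSupp d ((ℓ' - i) * S - 2 * Δ)) t x a| ≤ W (ℓ' - i) := fun x =>
        (by simpa using PiLp.norm_apply_le (b x - realTrigPoly (cubeSupp d ((ℓ' - i) * S - 2 * Δ)) t x) a :
          |b x a - realTrigPoly (cubeSupp d ((ℓ' - i) * S - 2 * Δ)) t x a| ≤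
            ‖b x - realTrigPoly (cubeSupp d ((ℓ' - i) * S - 2 * Δ)) t x‖).trans (htW x)
      have htail := abs_integral_mul_inner_realTrigPoly_le_of_coeff_vanish ((hPm i).sub (hPm (i + 1))) (hba a)
        (fun k hk => neg_mem_cubeSupp hk) hFlsym htc (hΦc a) a hvan hε
      refine htail.trans ?_
      have hW0 : 0 ≤ W (ℓ' - i) := (abs_nonneg _).trans (hε 0)
      have hvn : Real.sqrt (∫ x, ‖(P i - P (i + 1)) x‖ ^ 2) ≤ Real.sqrt (rungEnergy K₀ S Δ i u) :=
        Real.sqrt_le_sqrt (integral_norm_sq_rungPiece_le (K₀ := K₀) hΔ hS (le_trans (Nat.mul_le_mul_right _ (by omega)) hℓ) hui)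
      exact mul_le_mul (mul_le_mul_of_nonneg_left hvn hW0) (hΦn a) (Real.sqrt_nonneg _) (mul_nonneg hW0 (Real.sqrt_nonneg _))
    · -- the top piece
      have hvan : ∀ y ∈ cubeSupp d ((ℓ' + 1) * S - 2 * Δ), ∀ k ∈ Fl,
          mFourierCoeff (EuclideanSpace.complexify ∘ (u - P 0)) (y + k) = 0 := fun y hy k hk =>
        mFourierCoeff_topPiece_eq_zero_of_cube (K₀ := K₀) hΔ hS (by omega) hℓ hui hy hk
      obtain ⟨t, htc, htW⟩ := hW _ (by omega : 1 ≤ ℓ' + 1) le_rfl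
      have hε : ∀ x, |b x a - realTrigPoly (cubeSupp d ((ℓ' + 1) * S - 2 * Δ)) t x a| ≤ W (ℓ' + 1) := fun x =>
        (by simpa using PiLp.norm_apply_le (b x - realTrigPoly (cubeSupp d ((ℓ' + 1) * S - 2 * Δ)) t x) a :
          |b x a - realTrigPoly (cubeSupp d ((ℓ' + 1) * S - 2 * Δ)) t x a| ≤
            ‖b x - realTrigPoly (cubeSupp d ((ℓ' + 1) * S - 2 * Δ)) t x‖).trans (htW x)
      have htail := abs_integral_mul_inner_realTrigPoly_le_of_coeff_vanish (hu.sub (hPm 0)) (hba a)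
        (fun k hk => neg_mem_cubeSupp hk) hFlsym htc (hΦc a) a hvan hε
      refine htail.trans ?_
      have hW0 : 0 ≤ W (ℓ' + 1) := (abs_nonneg _).trans (hε 0)
      have hvn : Real.sqrt (∫ x, ‖(u - P 0) x‖ ^ 2) ≤ Real.sqrt (∫ x, ‖u x‖ ^ 2) :=
        Real.sqrt_le_sqrt (integral_norm_sq_sub_rungProj_zero_le (K₀ := K₀) hu)
      exact mul_le_mul (mul_le_mul_of_nonneg_left hvn hW0) (hΦn a) (Real.sqrt_nonneg _) (mul_nonneg hW0 (Real.sqrt_nonneg _))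
  -- ### Step 3: assemble
  have hsumrem : |∑ a, ∫ x, b x a * ⟪u x - P ℓ' x, realTrigPoly Fl (rungTestCoeff K₀ S Δ (ℓ' + 1) u a) x⟫_ℝ| ≤
      Fintype.card d * ((∑ i ∈ Finset.range ℓ', W (ℓ' - i) * Real.sqrt (rungEnergy K₀ S Δ i u) +
        W (ℓ' + 1) * Real.sqrt (∫ x, ‖u x‖ ^ 2)) * (2 * Real.pi * (H + 2 * Δ) * Real.sqrt (rungEnergy K₀ S Δ (ℓ' + 1) u))) := by
    refine (Finset.abs_sum_le_sum_abs _ _).trans ?_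
    refine (Finset.sum_le_sum fun a _ => hrem a).trans ?_
    rw [Finset.sum_const, Finset.card_univ, nsmul_eq_mul]
  have h3 := (abs_sub_abs_le_abs_sub _ _).trans hmain'
  have hfin := add_le_add h3 hsumrem
  rw [sub_add_cancel] at hfin
  refine hfin.trans_eq ?_
  ring

end RungFluxApprox

end Torus
end Literature.Analysis.FunctionSpaces

end
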